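import Literature.Probability.Distributions.GaussianSphereMarginal
import HarnessLib

/-!
# Independence of the direction block and the radius of a Gaussian vector

`Literature/Probability/Distributions/`. For independent standard Gaussian vectors `x ∈ E₁`, `y ∈ F`
of finite-dimensional real inner product spaces (`dim F ≥ 1`), the `E₁`-block
`b = x/√(‖x‖² + ‖y‖²)` of the direction `(x, y)/‖(x, y)‖` (`sphereMarginalMap E₁ F`, sibling file
`GaussianSphereMarginal`) and the squared radius `Q = ‖x‖² + ‖y‖²` are **independent**:

* `lintegral_comp_sphereMarginalMap_normSq` — the disintegration
  `∫⁻ G(b, Q) d(γ_{E₁} ⊗ γ_F) = ∫⁻_{s>0} W(s) (∫⁻ G(b, s) σ(b) db) ds` for jointly measurable `G ≥ 0`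
  (the computation `lintegral_comp_sphereMarginalMap` of the sibling file with the radial variable
  `s` carried along: `sphereFibre`, `sphereWeight`, `sphereMarginalDensity` are its integrands);
* `map_sphereMarginalMap_normSq_eq_prod` — consequently the joint law of `(b, Q)` is the product of
  the two marginal laws (`Measure.prod_eq` on rectangles).

This is the polar factorisation of the rotation-invariant Gaussian measure of `E₁ ⊕ F` (direction
uniform on the sphere and independent of the radius), restricted to what the sphere-marginal /
Maxwell–Borel computations use. All [folklore] (e.g. Muirhead, *Aspects of multivariate
statistical theory*, Thm. 1.5.6).
-/

noncomputable section

open MeasureTheory ProbabilityTheory Set Real Metric Module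
open scoped ENNReal

namespace Literature.Probability.Distributions

variable {E₁ : Type*} [NormedAddCommGroup E₁] [InnerProductSpace ℝ E₁] [FiniteDimensional ℝ E₁]
  [MeasurableSpace E₁] [BorelSpace E₁]
variable {F : Type*} [NormedAddCommGroup F] [InnerProductSpace ℝ F] [FiniteDimensional ℝ F]
  [MeasurableSpace F] [BorelSpace F]

omit [FiniteDimensional ℝ E₁] in
/-- Joint measurability in `(x, s)` of the fibre integrand `sphereFibre` with an `s`-dependent test
function `G(·, s)`. [folklore] -/
theorem measurable_sphereFibre_of_uncurry {G : E₁ → ℝ → ℝ≥0∞} (hG : Measurable (Function.uncurry G)) :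
    Measurable fun p : E₁ × ℝ => sphereFibre (F := F) (fun b => G b p.2) p.1 p.2 := by
  unfold sphereFibre
  refine Measurable.ite ?_ ?_ measurable_const
  · exact measurableSet_lt (by fun_prop) (by fun_prop)
  · have h1 : Measurable fun p : E₁ × ℝ => G ((√p.2)⁻¹ • p.1) p.2 :=
      hG.comp (g := Function.uncurry G) (f := fun p : E₁ × ℝ => ((√p.2)⁻¹ • p.1, p.2)) (by fun_prop)
    exact h1.mul (ENNReal.measurable_ofReal.comp (measurable_normSqDensity.comp (by fun_prop)))

omit [FiniteDimensional ℝ E₁] in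
/-- **Inner integral, radius carried along.** For fixed `x ∈ E₁` and jointly measurable `G ≥ 0`,
integrating out the Gaussian `y ∈ F` through `t = ‖y‖²` and shifting `s = ‖x‖² + t`:
`∫⁻ G(x/√(‖x‖²+‖y‖²), ‖x‖²+‖y‖²) dγ_F(y) = ∫⁻_{s>0} 𝟙_{‖x‖²<s} G(x/√s, s) ψ_F(s − ‖x‖²) ds`.
[folklore] -/
theorem lintegral_sphereMarginalMap_normSq_fibre [Nontrivial F] {G : E₁ → ℝ → ℝ≥0∞}
    (hG : Measurable (Function.uncurry G)) (x : E₁) :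
    ∫⁻ y, G (sphereMarginalMap E₁ F (x, y)) (‖x‖ ^ 2 + ‖y‖ ^ 2) ∂(stdGaussian F) =
      ∫⁻ s in Ioi (0 : ℝ), sphereFibre (F := F) (fun b => G b s) x s := by
  have hGx : Measurable fun t : ℝ => G ((√(‖x‖ ^ 2 + t))⁻¹ • x) (‖x‖ ^ 2 + t) :=
    hG.comp (g := Function.uncurry G) (f := fun t : ℝ => ((√(‖x‖ ^ 2 + t))⁻¹ • x, ‖x‖ ^ 2 + t))
      (by fun_prop)
  have h1 := lintegral_comp_norm_sq_stdGaussian (F := F) _ hGx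
  simp only [sphereMarginalMap]
  rw [h1]
  set f : ℝ → ℝ≥0∞ := fun s => G ((√s)⁻¹ • x) s * ENNReal.ofReal (normSqDensity F (s - ‖x‖ ^ 2))
    with hf
  have h2 : ∫⁻ t in Ioi (0 : ℝ), G ((√(‖x‖ ^ 2 + t))⁻¹ • x) (‖x‖ ^ 2 + t) *
      ENNReal.ofReal (normSqDensity F t) = ∫⁻ t in Ioi (0 : ℝ), f (‖x‖ ^ 2 + t) := by
    refine lintegral_congr fun t => ?_
    simp only [hf, add_sub_cancel_left]
  rw [h2, lintegral_Ioi_comp_const_add f (‖x‖ ^ 2)]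
  have hsub : Ioi (‖x‖ ^ 2) = Ioi (‖x‖ ^ 2) ∩ Ioi (0 : ℝ) := by
    rw [Ioi_inter_Ioi, sup_eq_left.2 (sq_nonneg _)]
  rw [hsub, ← Measure.restrict_restrict measurableSet_Ioi,
    ← lintegral_indicator (measurableSet_Ioi : MeasurableSet (Ioi (‖x‖ ^ 2)))]
  refine lintegral_congr fun s => ?_
  unfold sphereFibre
  by_cases hs : ‖x‖ ^ 2 < s
  · rw [indicator_of_mem (show s ∈ Ioi (‖x‖ ^ 2) from hs), if_pos hs]
  · rw [indicator_of_notMem (show s ∉ Ioi (‖x‖ ^ 2) from hs), if_neg hs]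

/-- **Disintegration of `(b, Q)`.** For jointly measurable `G ≥ 0`,
`∫⁻ G(x/‖(x,y)‖, ‖(x,y)‖²) d(γ_{E₁} ⊗ γ_F)(x,y) = ∫⁻_{s>0} W(s) (∫⁻ G(b, s) σ(b) db) ds` with the
weight `W = sphereWeight` and the un-normalised sphere-marginal density `σ = sphereMarginalDensity`
of the sibling file: Tonelli in `(x, y)`, the inner integral through `s = ‖x‖² + ‖y‖²`
(`lintegral_sphereMarginalMap_normSq_fibre`), Tonelli again and the rescaling `x = √s·b` at fixed `s`
(`lintegral_gaussianDensity_mul_sphereFibre`). [folklore] -/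
theorem lintegral_comp_sphereMarginalMap_normSq [Nontrivial F] {G : E₁ → ℝ → ℝ≥0∞}
    (hG : Measurable (Function.uncurry G)) :
    ∫⁻ p, G (sphereMarginalMap E₁ F p) (‖p.1‖ ^ 2 + ‖p.2‖ ^ 2) ∂((stdGaussian E₁).prod (stdGaussian F)) =
      ∫⁻ s in Ioi (0 : ℝ), ENNReal.ofReal (sphereWeight (E₁ := E₁) (F := F) s) *
        ∫⁻ b, G b s * ENNReal.ofReal (sphereMarginalDensity (finrank ℝ F) b) := by
  have hM : Measurable fun v : E₁ =>
      ENNReal.ofReal ((2 * π) ^ (-(finrank ℝ E₁ : ℝ) / 2) * rexp (-‖v‖ ^ 2 / 2)) := by fun_prop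
  have hJ : Measurable fun p : E₁ × ℝ => sphereFibre (F := F) (fun b => G b p.2) p.1 p.2 :=
    measurable_sphereFibre_of_uncurry hG
  have hJx : ∀ x, Measurable fun s => sphereFibre (F := F) (fun b => G b s) x s := fun x =>
    hJ.comp measurable_prodMk_left
  have hI : Measurable fun x : E₁ => ∫⁻ s in Ioi (0 : ℝ), sphereFibre (F := F) (fun b => G b s) x s :=
    hJ.lintegral_prod_right'
  have hGs : ∀ s, Measurable fun b => G b s := fun s => hG.comp measurable_prodMk_right
  have hmeas : Measurable fun p : E₁ × F => G (sphereMarginalMap E₁ F p) (‖p.1‖ ^ 2 + ‖p.2‖ ^ 2) :=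
    hG.comp (g := Function.uncurry G)
      (f := fun p : E₁ × F => (sphereMarginalMap E₁ F p, ‖p.1‖ ^ 2 + ‖p.2‖ ^ 2)) (by fun_prop)
  calc ∫⁻ p, G (sphereMarginalMap E₁ F p) (‖p.1‖ ^ 2 + ‖p.2‖ ^ 2) ∂((stdGaussian E₁).prod (stdGaussian F))
      = ∫⁻ x, ∫⁻ y, G (sphereMarginalMap E₁ F (x, y)) (‖x‖ ^ 2 + ‖y‖ ^ 2) ∂(stdGaussian F)
          ∂(stdGaussian E₁) := lintegral_prod _ hmeas.aemeasurable
    _ = ∫⁻ x, (∫⁻ s in Ioi (0 : ℝ), sphereFibre (F := F) (fun b => G b s) x s) ∂(stdGaussian E₁) :=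
        lintegral_congr fun x => lintegral_sphereMarginalMap_normSq_fibre hG x
    _ = ∫⁻ x, ∫⁻ s in Ioi (0 : ℝ),
          ENNReal.ofReal ((2 * π) ^ (-(finrank ℝ E₁ : ℝ) / 2) * rexp (-‖x‖ ^ 2 / 2)) *
            sphereFibre (F := F) (fun b => G b s) x s := by
        rw [lintegral_stdGaussian_eq_lintegral_mul hI]
        refine lintegral_congr fun x => ?_
        rw [lintegral_const_mul _ (hJx x)]
    _ = ∫⁻ s in Ioi (0 : ℝ), ∫⁻ x,
          ENNReal.ofReal ((2 * π) ^ (-(finrank ℝ E₁ : ℝ) / 2) * rexp (-‖x‖ ^ 2 / 2)) *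
            sphereFibre (F := F) (fun b => G b s) x s := by
        refine lintegral_lintegral_swap ?_
        exact ((hM.comp measurable_fst).mul hJ).aemeasurable
    _ = ∫⁻ s in Ioi (0 : ℝ), ENNReal.ofReal (sphereWeight (E₁ := E₁) (F := F) s) *
          ∫⁻ b, G b s * ENNReal.ofReal (sphereMarginalDensity (finrank ℝ F) b) :=
        setLIntegral_congr_fun measurableSet_Ioi fun s hs =>
          lintegral_gaussianDensity_mul_sphereFibre (hGs s) hs

/-- The rectangle form of the disintegration: for measurable `A ⊆ E₁`, `B ⊆ ℝ`,
`P(b ∈ A, Q ∈ B) = (∫⁻_{s>0} W(s) 𝟙_B(s) ds) · ∫⁻_A σ`. [folklore] -/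
theorem measure_sphereMarginalMap_normSq_preimage_prod [Nontrivial F] {A : Set E₁}
    (hA : MeasurableSet A) {B : Set ℝ} (hB : MeasurableSet B) :
    (stdGaussian E₁).prod (stdGaussian F)
        ((fun p : E₁ × F => (sphereMarginalMap E₁ F p, ‖p.1‖ ^ 2 + ‖p.2‖ ^ 2)) ⁻¹' (A ×ˢ B)) =
      (∫⁻ s in Ioi (0 : ℝ), ENNReal.ofReal (sphereWeight (E₁ := E₁) (F := F) s) * B.indicator 1 s) *
        ∫⁻ b in A, ENNReal.ofReal (sphereMarginalDensity (finrank ℝ F) b) := by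
  have hT : Measurable fun p : E₁ × F => (sphereMarginalMap E₁ F p, ‖p.1‖ ^ 2 + ‖p.2‖ ^ 2) := by
    fun_prop
  have hG : Measurable (Function.uncurry fun (b : E₁) (s : ℝ) =>
      A.indicator (1 : E₁ → ℝ≥0∞) b * B.indicator (1 : ℝ → ℝ≥0∞) s) := by
    change Measurable fun p : E₁ × ℝ => A.indicator 1 p.1 * B.indicator 1 p.2
    exact ((measurable_one.indicator hA).comp measurable_fst).mul
      ((measurable_one.indicator hB).comp measurable_snd)
  have h1 := lintegral_comp_sphereMarginalMap_normSq (E₁ := E₁) (F := F) hG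
  have hind : ∀ p : E₁ × F,
      ((fun p : E₁ × F => (sphereMarginalMap E₁ F p, ‖p.1‖ ^ 2 + ‖p.2‖ ^ 2)) ⁻¹' (A ×ˢ B)).indicator
          (1 : E₁ × F → ℝ≥0∞) p =
        A.indicator 1 (sphereMarginalMap E₁ F p) * B.indicator 1 (‖p.1‖ ^ 2 + ‖p.2‖ ^ 2) := by
    intro p
    by_cases hA' : sphereMarginalMap E₁ F p ∈ A <;> by_cases hB' : ‖p.1‖ ^ 2 + ‖p.2‖ ^ 2 ∈ B <;>
      simp [hA', hB', Set.mem_prod]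
  rw [← lintegral_indicator_one (hT (hA.prod hB))]
  simp_rw [hind]
  rw [h1]
  have hσ : Measurable fun b : E₁ => ENNReal.ofReal (sphereMarginalDensity (finrank ℝ F) b) := by
    fun_prop
  have inner : ∀ s : ℝ, ∫⁻ b, A.indicator (1 : E₁ → ℝ≥0∞) b * B.indicator (1 : ℝ → ℝ≥0∞) s *
      ENNReal.ofReal (sphereMarginalDensity (finrank ℝ F) b) =
        B.indicator 1 s * ∫⁻ b in A, ENNReal.ofReal (sphereMarginalDensity (finrank ℝ F) b) := by
    intro s
    rw [← lintegral_indicator hA, ← lintegral_const_mul _ (hσ.indicator hA)]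
    refine lintegral_congr fun b => ?_
    by_cases hb : b ∈ A
    · simp [Set.indicator_of_mem hb, mul_comm]
    · simp [Set.indicator_of_notMem hb]
  simp_rw [inner, ← mul_assoc]
  exact lintegral_mul_const _ ((ENNReal.measurable_ofReal.comp measurable_sphereWeight).mul
    (measurable_one.indicator hB))

/-- **Independence of the direction block and the squared radius.** For independent standard
Gaussian vectors `x ∈ E₁`, `y ∈ F` (`dim F ≥ 1`), the joint law of
`(x/√(‖x‖²+‖y‖²), ‖x‖²+‖y‖²)` is the product of the laws of its two components. [folklore] -/
theorem map_sphereMarginalMap_normSq_eq_prod [Nontrivial F] :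
    ((stdGaussian E₁).prod (stdGaussian F)).map
        (fun p => (sphereMarginalMap E₁ F p, ‖p.1‖ ^ 2 + ‖p.2‖ ^ 2)) =
      (((stdGaussian E₁).prod (stdGaussian F)).map (sphereMarginalMap E₁ F)).prod
        (((stdGaussian E₁).prod (stdGaussian F)).map fun p => ‖p.1‖ ^ 2 + ‖p.2‖ ^ 2) := by
  have hb : Measurable (sphereMarginalMap E₁ F) := measurable_sphereMarginalMap
  have hQ : Measurable fun p : E₁ × F => ‖p.1‖ ^ 2 + ‖p.2‖ ^ 2 := by fun_prop
  have hT : Measurable fun p : E₁ × F => (sphereMarginalMap E₁ F p, ‖p.1‖ ^ 2 + ‖p.2‖ ^ 2) :=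
    hb.prodMk hQ
  haveI : IsProbabilityMeasure (((stdGaussian E₁).prod (stdGaussian F)).map (sphereMarginalMap E₁ F)) :=
    Measure.isProbabilityMeasure_map hb.aemeasurable
  haveI : IsProbabilityMeasure (((stdGaussian E₁).prod (stdGaussian F)).map
      fun p : E₁ × F => ‖p.1‖ ^ 2 + ‖p.2‖ ^ 2) :=
    Measure.isProbabilityMeasure_map hQ.aemeasurable
  -- notation for the two factors of the rectangle formula
  set WB : Set ℝ → ℝ≥0∞ := fun B => ∫⁻ s in Ioi (0 : ℝ),
    ENNReal.ofReal (sphereWeight (E₁ := E₁) (F := F) s) * B.indicator 1 s with hWB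
  set σA : Set E₁ → ℝ≥0∞ := fun A => ∫⁻ b in A, ENNReal.ofReal (sphereMarginalDensity (finrank ℝ F) b)
    with hσA
  have key : ∀ A, MeasurableSet A → ∀ B, MeasurableSet B →
      (stdGaussian E₁).prod (stdGaussian F)
        ((fun p : E₁ × F => (sphereMarginalMap E₁ F p, ‖p.1‖ ^ 2 + ‖p.2‖ ^ 2)) ⁻¹' (A ×ˢ B)) =
        WB B * σA A := fun A hA B hB =>
    measure_sphereMarginalMap_normSq_preimage_prod hA hB
  have eA : ∀ A : Set E₁, sphereMarginalMap E₁ F ⁻¹' A =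
      (fun p : E₁ × F => (sphereMarginalMap E₁ F p, ‖p.1‖ ^ 2 + ‖p.2‖ ^ 2)) ⁻¹' (A ×ˢ univ) := by
    intro A; ext p; simp [Set.mem_prod]
  have eB : ∀ B : Set ℝ, (fun p : E₁ × F => ‖p.1‖ ^ 2 + ‖p.2‖ ^ 2) ⁻¹' B =
      (fun p : E₁ × F => (sphereMarginalMap E₁ F p, ‖p.1‖ ^ 2 + ‖p.2‖ ^ 2)) ⁻¹' (univ ×ˢ B) := by
    intro B; ext p; simp [Set.mem_prod]
  have hmass : WB univ * σA univ = 1 := by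
    have h := key univ MeasurableSet.univ univ MeasurableSet.univ
    rw [Set.univ_prod_univ, Set.preimage_univ, measure_univ] at h
    exact h.symm
  symm
  refine Measure.prod_eq fun A B hA hB => ?_
  rw [Measure.map_apply hT (hA.prod hB), Measure.map_apply hb hA, Measure.map_apply hQ hB,
    key A hA B hB, eA, eB, key A hA univ MeasurableSet.univ, key univ MeasurableSet.univ B hB]
  calc WB B * σA A = (WB univ * σA univ) * (WB B * σA A) := by rw [hmass, one_mul]
    _ = WB univ * σA A * (WB B * σA univ) := by ring

end Literature.Probability.Distributions

end
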